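import Summits.HodgeConjecture.HodgeConjecture.Theorems.R90S6TreeFixDataFlickerU3HypCorner     -- ★ FILE 0c (this seat): (H.2c) `flickerFix_natCard_fixedBy_hyp_tOne_corner`, (H.1c) `…_hyp_tpi_corner`
import Summits.HodgeConjecture.HodgeConjecture.Theorems.R90S6FlickerLiteralShiftAdjoin           -- ★ R2M B (p05): `exists_v_eq_v_pow_of_ne_zero`
import Literature.NumberTheory.Rogawski1990.UnitOrbitalIntegralInertValueThetaZeroTrichotomy        -- ★ `UnitaryGroup.add_sub_two_mul_ne_zero_of_normOne` (`a + c ≠ 2b`)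
import Literature.NumberTheory.Automorphic.ValuedFieldValuativeRelBridge                            -- ★ Valued ∕ ValuativeRel dictionary (already below FILE 0c; listed for the frame)
import HarnessLib

/-!
# R90 · S6 «Ch. 14.1–14.5 stable trace formula» — card GF1 FILE 2b, UNIPOTENT BLOCK: THE HYPERSPECIAL COLUMN OF `t_1(a,b,c)` WITH THE THREE DEPTH LETTERS ONLY —
# `V₀(t₁) = φ₀(q; N₁, N₂, N)` for `|a − b| = |ϖ^{N₁}|`, `|c − b| = |ϖ^{N₂}|`, `|a − c| = |ϖ^N|`, every regime incl. R-I `a ≡ b ≡ c` (`Theorems/R90S6TreeFixDataFlickerU3Unipotent.lean`)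

Cell `hodgecm-mathlib`, crux H413 (`stmt-HodgeConjecture-24833`), route of record `HCCMUnconditional`; programme R90-TF (brief `director/R90-BRIEF.v2.md`
1f40d54518340a35), section S6 (base `R90-C14`, dealer R90-C14-plan (g3)), seat R90-C14-p10 (g2); card GF1 FILE 2b (cut K2Liu-p14 (g5) 02:49:55Z; dealer rulings «R-I twin →
p05», «2b-Unipotent = p10 assembles»).  Lane `--kind proof --supports stmt-HodgeConjecture-24833 --as helper`; ONE THEOREM (no definition, no instance, no notation, no named
fact, no kit, no `sorry`); imports = ★ FILE 0c + ★ R2M B + ★ Literature `…ThetaZeroTrichotomy`, `ValuedFieldValuativeRelBridge` + HarnessLib (never `Lines/`).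

THE PARTNER FILE.  p05's R-I twin `R90S6TorusFixedSpecialCountUnipotentFlicker` gives the SPECIAL column of the Flicker literals with ALL THREE eigenvalues residually
congruent: `V₁(t_1(a,b,c)) + φ₀(N₁−1, N₂−1, N−1) = 1 + S·φ₀(N₁−1, N₂−1, N−1)` and `V₁(t_ϖ(a,b,c)) + φ₁(N₁−1, N−1) = 1 + S·φ₁(N₁−1, N−1)` (`S = #star(L₀) = q³+1` at the pins),
in the regime letters `{N₁ N₂ N} (hN₁ : |a − b| = |ϖ^{N₁}|) (hN₂ : |c − b| = |ϖ^{N₂}|) (hN : |a − c| = |ϖ^N|) (h₁ : 1 ≤ N₁) (h₃ : 1 ≤ N) (htri)` and the ★ corner frame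
(`hd : LocalConjDatum`, complete DVR integers, `#𝓀 = q²` as `Nat.card`, `hσO`, `y σy = −2`, `a₀`).  THE HYPERSPECIAL column needs NO regime at all: ★ FILE 0c (H.1c) gives
`V₀(t_ϖ(a,b,c)) = φ₁(q; N₁, N)` from `hN hN₁ hN₂` directly (cite it by name; `t_ϖ(a,c,b)`, `t_ϖ(b,a,c)` by relabelling), and THIS FILE removes the one extraneous letter of
★ FILE 0c (H.2c) — the exponent `N₊` of `a + c − 2b`, which EXISTS (`a + c ≠ 2b` for norm-one `a ≠ c`, ★ `add_sub_two_mul_ne_zero_of_normOne`; integral, so ★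
`exists_v_eq_v_pow_of_ne_zero`) and on which `φ₀(q; N₁, N₂, N)` does not depend:
* (U.1) **`flickerFix_natCard_fixedBy_hyp_tOne_depths`** — `V₀(t_1(a,b,c)) = phiZero q N₁ N₂ N` in `ℚ` from the three depth letters `hN₁ hN₂ hN` alone, every regime
  (R-III: `(0,0,0) ↦ 1`; R-II(a≡b): `(n,0,0)` = ★ 2b-Congruent (C.1); R-I: p05's letters VERBATIM, so the (U1)-deep-R-I discharge (R90-C14-p02) and K2Liu-p14's FLSUM
  (`k = 3` instance) substitute `(V₀, V₁)(t₁)` and `(V₀, V₁)(t_ϖ)` BY NAME under one binder set).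
HONEST LABEL: binder hygiene over a ★ closed form (the unit-FL hyperspecial count), count-neutral until (U1) ∕ (E1); proves no printed global statement, discharges no citation;
HC_CM is proved only modulo the 7 printed citations (2 remaining named inputs: hLiu418 = stmt-HodgeConjecture-24832, h413 = stmt-HodgeConjecture-24833) until rung 0 closes.
REL ≠ ★ ≠ BUILT.

## References
* [Flicker1998UnitaryFL] Y. Z. Flicker, *Elementary proof of the fundamental lemma for a unitary group*, Canad. J. Math. 50 (1998): Prop. 13 p. 91 (`a + c ≠ 2b`), Prop. 14
  p. 94 (`θ̄ = 0`), §6 p. 95.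
* [Rogawski1990] J. D. Rogawski, *Automorphic Representations of Unitary Groups in Three Variables*, Ann. of Math. Stud. 123 (1990): §4.9 Prop. 4.9.1 (b) pp. 54–55.
* [Kottwitz1986BaseChangeUnits] R. E. Kottwitz, *Base change for unit elements of Hecke algebras*, Compositio Math. 60 (1986): §1 pp. 240–241, §3.
-/

set_option autoImplicit false
-- the mandated namespace repeats the single-problem summit's segment (`HodgeConjecture.HodgeConjecture`)
set_option linter.dupNamespace false

noncomputable section

open MulAction IsLocalRing
open scoped Valued WithZero Matrix MatrixGroups
open Literature.NumberTheory.Automorphic Literature.NumberTheory.Automorphic.HermitianLattice Literature.NumberTheory.Automorphic.UnitaryLatticeTree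
  Literature.NumberTheory.Automorphic.UnitaryGroup
open Literature.NumberTheory.Rogawski1990.Flicker1998 (phiZero)

namespace Summit.HodgeConjecture.HodgeConjecture.R90.S6

section Depths

variable {K : Type*} [Field K] [Valued K ℤᵐ⁰] [ValuativeRel K] [(Valued.v : Valuation K ℤᵐ⁰).Compatible]
  [IsDiscreteValuationRing (Valued.integer K)] [Finite (ResidueField (Valued.integer K))] [IsAdicComplete (maximalIdeal (Valued.integer K)) (Valued.integer K)]
  {σ : K →+* K} {ϖ : K}

set_option synthInstance.maxHeartbeats 200000 in
-- as in the ★ corner heads: the `H`-action on `H ⧸ (K^{u_m} ∩ H)` is found through the large subgroup terms of the `U(2,1)` frame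
/-- **(U.1) `V₀(t_1(a,b,c)) = φ₀(q; N₁, N₂, N)` FROM THE THREE DEPTH LETTERS** — the hyperspecial fixed-coset count of Flicker's `θ̄ = 0` literal
`t_1(a,b,c) = !![e(a+c), 0, −e(a−c); 0, b, 0; −e(a−c), 0, e(a+c)]` ((E1) sheet's `hγ₁` bytes) in GF1's coset currency, for norm-one `a, b, c` with `|a − b| = |ϖ^{N₁}|`,
`|c − b| = |ϖ^{N₂}|`, `|a − c| = |ϖ^N|` (ANY `N₁, N₂, N`; in regime R-I these are p05's R-I-twin letters verbatim): `#Fix_γ(U ⧸ (GL₃(𝒪) ⊓ U)) = phiZero q N₁ N₂ N` in `ℚ` — ★ FILE 0c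
(H.2c) with its exponent letter `hNp` DISCHARGED: `a + c − 2b ≠ 0` (★ `add_sub_two_mul_ne_zero_of_normOne`, as `a ≠ c` from `hN`) and is integral, so it has SOME exponent (★
`exists_v_eq_v_pow_of_ne_zero`), which the value does not see.  Frame = ★ corner's (`LocalConjDatum`, complete DVR integers with finite residue field, `hσO`, `y σy = −2`,
`#𝓀 = q²`, `a₀`).  Partner (V₁, regime R-I): p05's `natCard_fixedBy_special_flickerOne_add_phiZero_eq_of_unipotent`. [cite: Flicker1998UnitaryFL, Prop. 13 p. 91; Prop. 14 p. 94]
[cite: Rogawski1990, §4.9 Prop. 4.9.1 (b) p. 55] [cite: Kottwitz1986BaseChangeUnits, §3] -/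
theorem flickerFix_natCard_fixedBy_hyp_tOne_depths (hd : LocalConjDatum σ ϖ)
    (hσO : ∀ y : Valued.integer K, (σ.comp (Valued.integer K).subtype) y ∈ Valued.integer K) {y : K} (hy : y * σ y = -2)
    {q : ℕ} (hq : Nat.card (ResidueField (Valued.integer K)) = q ^ 2)
    {a₀ : Valued.integer K} (ha₀ : IsUnit (((σ.comp (Valued.integer K).subtype).codRestrict (Valued.integer K) hσO) a₀ - a₀))
    {e a b cc : K} (h2e : 2 * e = 1) (ha : σ a * a = 1) (hb : σ b * b = 1) (hcc : σ cc * cc = 1)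
    (γ : ↥(unitaryGroupOfForm σ ((StdForm.antidiagonal 3).over K)))
    (hγ : ((γ : GL (Fin 3) K) : Matrix (Fin 3) (Fin 3) K) = !![e * (a + cc), 0, -(e * (a - cc)); 0, b, 0; -(e * (a - cc)), 0, e * (a + cc)])
    {N₁ N₂ N : ℕ} (hN₁ : Valued.v (a - b) = Valued.v (ϖ ^ N₁)) (hN₂ : Valued.v (cc - b) = Valued.v (ϖ ^ N₂)) (hN : Valued.v (a - cc) = Valued.v (ϖ ^ N))
    [Fintype (fixedBy (↥(unitaryGroupOfForm σ ((StdForm.antidiagonal 3).over K)) ⧸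
      (glInt 3 K).subgroupOf (unitaryGroupOfForm σ ((StdForm.antidiagonal 3).over K))) γ)] :
    (Nat.card (fixedBy (↥(unitaryGroupOfForm σ ((StdForm.antidiagonal 3).over K)) ⧸
        (glInt 3 K).subgroupOf (unitaryGroupOfForm σ ((StdForm.antidiagonal 3).over K))) γ) : ℚ) = phiZero q N₁ N₂ N := by
  have hϖ0 : ϖ ≠ 0 := hd.ϖ_ne_zero
  have hac0 : a ≠ cc := by
    intro h; rw [h, sub_self, map_zero] at hN; exact pow_ne_zero _ hϖ0 ((map_eq_zero _).1 hN.symm)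
  have hva : Valued.v a = 1 := (flickerLiteral_norm_one_letters σ hd.vσ ha).2
  have hvb : Valued.v b = 1 := (flickerLiteral_norm_one_letters σ hd.vσ hb).2
  have hvc : Valued.v cc = 1 := (flickerLiteral_norm_one_letters σ hd.vσ hcc).2
  have hs1 : Valued.v (a + cc - 2 * b) ≤ 1 := by
    refine le_trans (Valuation.map_sub _ _ _) (max_le (le_trans (Valuation.map_add _ _ _) (max_le hva.le hvc.le)) ?_)
    rw [map_mul, hd.v2, one_mul]; exact hvb.le
  obtain ⟨Np, hNp⟩ := exists_v_eq_v_pow_of_ne_zero hd (add_sub_two_mul_ne_zero_of_normOne σ hd ha hb hcc hac0) hs1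
  exact flickerFix_natCard_fixedBy_hyp_tOne_corner hd hσO hy hq ha₀ h2e ha hb hcc γ hγ hN hNp hN₁ hN₂

end Depths

end Summit.HodgeConjecture.HodgeConjecture.R90.S6

end
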